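import Summits.ResolutionOfSingularities.ResolutionOfSingularities.Theorems.EquisingularLiftEquisingularLiftNatTowerRuledRoots
import Summits.ResolutionOfSingularities.ResolutionOfSingularities.Theorems.EquisingularLiftEquisingularLiftNatCentreTwoFrame
import Summits.ResolutionOfSingularities.ResolutionOfSingularities.Theorems.EquisingularLiftEquisingularLiftNatNoseTowerSeed
import HarnessLib

/-!
# [OURS · L1 W4.5(b) · EL♮(3)] N1 — THE NOSE ROOT: `DirLift.Ruled` at the root `(X', C)` of the nose tower
# (the stand-in `hRootNose` of res-D-pv-018's nose assembly `hsub_reachNoseTower_three_of`, rung NOSE-TOWER₃ of the registered stub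
# `stub_elnat_ratNoseTowerResolution`; crux `EquisingularLiftNatThree` = stmt-ResolutionOfSingularities-20148, parent stmt-…-20038)

res-D-pv-035 g9 (D hand AS w45b; res-L1-w45b-plan-1 NAMING 2026-08-27T20:19:50Z «035 g9 → N1 `hRootNose` DISCHARGE»). OURS — planning
vocabulary of the crux chain w45b (cell `res-hironaka`, slot W4.5(b)); NOT a statement of H. Hironaka's manuscript or of any paper; AI-written,
weaker than expert review. No `sorry`; standard axioms; DEF-FREE. `--supports stmt-ResolutionOfSingularities-20148 --as helper`.

WHAT. In the NOSE block of HSUB′(ReachNoseTower₃) (text of record `D/res-D-pv-035/nose/HSUB-RATNOSETOWER3.sig.txt` cad6759341cbb034: the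
`Ch`-stage `(X', σ')` — integral, locally Noetherian, REGULAR — with model square `j : F₁ → X'` over `Spec θ`; a closed `Z ⊆ F₁`; the centre
`C ⊂ X'` — `V(C)` regular, `O`-flat, exact reduced trace `C·𝒪_{F₁} = 𝓘⟨Z⟩`, off the generic point of `Y`; its blowing up `τ₁ : X₁ → X'`; the
downstairs blowing up `υ : F₂ → F₁` of `𝓘⟨Z⟩` with model square `j₂ : F₂ → X₁`, `j₂ ≫ τ₁ = υ ≫ j`) the freshly created exceptional surface
`𝓔 := C·𝒪_{X₁}` CARRIES res-L1-w45b-stub-2's ruled-surface datum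
`DirLift.Ruled O k θ P q Y F₁ Z hZ F₂ υ F₂ (𝟙 F₂) (υ ⁻¹' Z) X₁ (τ₁ ≫ σ') j₂ (C.comap τ₁)` — VERBATIM the type of the stand-in `hRootNose` of
`…NatNoseTowerAssembly` (res-D-pv-018, 89a09200257d3688) and of `hRuled` in `Tower.inv₂_noseSeed` (p565384) — MODULO TWO NAMED INPUTS:
* `hcodim` — codimension two of the centre at its points, `dim (𝒪_{X',x} ⧸ C_x) + 2 = dim 𝒪_{X',x}` on `supp C` (res-L1-w45b-stub-3's (β)
  T-DIM-CENTRE discharges it; here a binder, exactly the hypothesis of `forall_exists_twoFrame_of_isRegular`, p564791);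
* `hCrat` — the CONDITIONAL UPSTAIRS RATIONALITY of the centre, `RationalCarrier Z̃ → (V(C) ≅ ℙ¹_O over Spec O)` (residue (T-j); res-L1-type-o6's
  (d)/(R4) object; binder text = `ROOTS-INPUTS.sig.txt` 978abd3aff7daeaa (d) read at `(X', σ', C)`).
PROOF. The nose root IS a curve-step root: `DirLift.ruled_curveStep_root` (p562947) applies verbatim at `(X := X', σ := σ', jG := j, tG := t,
𝒞 := C, X₁₀ := X₁, τ := τ₁, j₁₀ := j₂, t₁₀ := t₂)` with `υ' := υ`, `F₉ := F₁`, `Z₉ := Z`, `F₁₀ := F₂`; its input (b) `hCoff` is the block's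
pointwise clause re-bracketed, (c) `hCframe` is res-L1-w45b-stub-3's `forall_exists_twoFrame_of_isRegular` from (`hX'reg`, `hCreg`, `hcodim`), (a) is
the block's `hυ`, (d) is `hCrat`. `Tower.inv₂_noseSeed_root'` then re-exports res-D-pv-035's (seed) brick `Tower.inv₂_noseSeed'` with `hRuled`
DISCHARGED by N1, i.e. the (seed) clause of the nose assembly modulo (`hcodim`, `hCrat`) only.

References (OURS, index only): res-L1-w45b-stub-2 …NatTowerRuledDefs (p561677) / …NatTowerRuledRoots (p562947); res-L1-w45b-stub-3 …NatCentreTwoFrame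
(p564791); res-D-pv-035 …NatNoseTowerSeed (p565384) / …NatNoseTowerDriverThree (p564786); res-D-pv-018 …NatNoseTowerAssembly (mirror 89a09200257d3688).
[cite: Matsumura1987, Thm. 14.2, Thm. 16.2] (via p564791); [cite: GortzWedhorn2020, Prop. 13.91] (blow-ups, index only).
-/

set_option linter.dupNamespace false -- mandated namespace `Summit.<Summit>.<Problem>` of this single-conjunct summit
set_option linter.overlappingInstances false -- `Tower.inv₂_noseSeed_root'` carries `[IsDomain O] [IsDiscreteValuationRing O]`

noncomputable section

open CategoryTheory CategoryTheory.Limits AlgebraicGeometry TopologicalSpace Topology IsLocalRing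
open Literature.AlgebraicGeometry.Resolution
open Literature.AlgebraicGeometry.Morphisms (ProjCech.PP ProjCech.toSpec)
open AlgebraicGeometry.Scheme.IdealSheafData

namespace Summit.ResolutionOfSingularities.ResolutionOfSingularities.Cruxes.EquisingularLiftNat.Sections

/-- **N1 — the nose root carries `DirLift.Ruled`.** In the nose block of HSUB′(ReachNoseTower₃) (see the module docstring) the
exceptional surface `C·𝒪_{X₁}` of the blowing up `τ₁ : X₁ → X'` of the centre `C` carries res-L1-w45b-stub-2's ruled-surface datum at
the seed stage `(F₂, 𝟙, υ⁻¹ Z)` — the type of the stand-in `hRootNose` of res-D-pv-018's `hsub_reachNoseTower_three_of`, verbatim —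
given the codimension-two clause `hcodim` of `C` at its points and the conditional upstairs rationality `hCrat` of `C`.
[cite: Matsumura1987, Thm. 14.2, Thm. 16.2] [OURS · L1 W4.5b · pure composition of p562947 and p564791] toward
`stub_elnat_ratNoseTowerResolution` (stmt-ResolutionOfSingularities-20148); NOT a statement of the manuscript. -/
theorem DirLift.ruled_noseRoot (O : Type) [CommRing O] (k : Type) [Field k] (θ : O →+* k)
    (P : Scheme.{0}) (q : P ⟶ Spec (.of O)) (Y : Set P)
    -- the stage before the nose and its model
    (X' : Scheme.{0}) (σ' : X' ⟶ P) (hX'int : IsIntegral X') (hX'noeth : IsLocallyNoetherian X') (hX'reg : Scheme.IsRegular X')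
    (F₁ : Scheme.{0}) (j : F₁ ⟶ X') (t : F₁ ⟶ Spec (.of k)) (hsq : IsPullback j t (σ' ≫ q) (Spec.map (CommRingCat.ofHom θ)))
    -- the nose block
    (Z : Set F₁) (hZ : IsClosed Z)
    (C : X'.IdealSheafData) (hCreg : Scheme.IsRegular C.subscheme) (hCfl : Flat (C.subschemeι ≫ σ' ≫ q))
    (hCj : C.comap j = vanishingIdeal (⟨Z, hZ⟩ : Closeds F₁))
    (hCoff : ∀ c ∈ (C.support : Set X'), ¬ IsGenericPoint (σ' c) Y)
    (X₁ : Scheme.{0}) (τ₁ : X₁ ⟶ X') (hτ₁ : IsBlowup τ₁ C)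
    (F₂ : Scheme.{0}) (υ : F₂ ⟶ F₁) (hυ : IsBlowup υ (vanishingIdeal (⟨Z, hZ⟩ : Closeds F₁)))
    (j₂ : F₂ ⟶ X₁) (t₂ : F₂ ⟶ Spec (.of k)) (hsq₂ : IsPullback j₂ t₂ ((τ₁ ≫ σ') ≫ q) (Spec.map (CommRingCat.ofHom θ)))
    (hcomm : j₂ ≫ τ₁ = υ ≫ j)
    -- (R3) input — codimension two of the centre at its points (res-L1-w45b-stub-3's (β) T-DIM-CENTRE; here a binder)
    (hcodim : ∀ x ∈ C.support, ringKrullDim (X'.presheaf.stalk x ⧸ stalkIdeal C x) + 2 = ringKrullDim (X'.presheaf.stalk x))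
    -- (R4) input — conditional upstairs rationality of the centre (residue (T-j); res-L1-type-o6's `hCrat`; here a binder)
    (hCrat : RationalCarrier (redSub F₁ Z hZ) →
      ∃ e₁ : C.subscheme ≅ ProjCech.PP O 1, e₁.hom ≫ ProjCech.toSpec O 1 = C.subschemeι ≫ σ' ≫ q) :
    DirLift.Ruled O k θ P q Y F₁ Z hZ F₂ υ F₂ (𝟙 F₂) (υ ⁻¹' Z) X₁ (τ₁ ≫ σ') j₂ (C.comap τ₁) := by
  haveI := hX'int
  haveI := hX'noeth
  exact DirLift.ruled_curveStep_root hυ X' σ' j t C X₁ τ₁ j₂ t₂ hX'reg hsq hCj hCfl hCreg hτ₁ hsq₂ hcomm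
    (by rintro _ ⟨c, hc, rfl⟩; exact hCoff c hc) (forall_exists_twoFrame_of_isRegular hX'reg C hCreg hcodim) hCrat

/-- **The (seed) clause of the nose assembly with N1 discharged**: res-D-pv-035's `Tower.inv₂_noseSeed'` (p565384) — `Tower.Inv₂` on the nose
seed `(F₂, 𝟙, closure υ⁻¹(T₁ ∖ Z), υ⁻¹ Z, ∅)` for `Ruled := DirLift.Ruled O k θ P q Y`, together with the assembly's three side conjuncts at
`K = ∅` — with its stand-in `hRuled` supplied by `DirLift.ruled_noseRoot`; what remains are the two named inputs `hcodim`, `hCrat` (and the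
block's `hCfl`). [cite: GortzWedhorn2020, Prop. 13.91] [cite: Liu2002, Thm. 8.1.19] [OURS · L1 W4.5b · pure composition] toward
`stub_elnat_ratNoseTowerResolution` via `hsub_reachNoseTower_three_of` (seed); NOT a statement of the manuscript. -/
theorem Tower.inv₂_noseSeed_root' (O : Type) [CommRing O] [IsDomain O] [IsDiscreteValuationRing O] (k : Type) [Field k]
    (θ : O →+* k) (hθ : Function.Surjective θ)
    (P : Scheme.{0}) (q : P ⟶ Spec (.of O)) (Y : Set P) (Ch : ∀ X' : Scheme.{0}, (X' ⟶ P) → Set X' → Prop)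
    (X' : Scheme.{0}) (σ' : X' ⟶ P) (hX'int : IsIntegral X') (hX'noeth : IsLocallyNoetherian X') (hX'reg : Scheme.IsRegular X')
    (F₁ : Scheme.{0}) (j : F₁ ⟶ X') (t : F₁ ⟶ Spec (.of k)) (hsq : IsPullback j t (σ' ≫ q) (Spec.map (CommRingCat.ofHom θ)))
    (T₁ : Set F₁)
    (Z : Set F₁) (hZ : IsClosed Z) (hT₁Z : ¬ T₁ ⊆ Z) (hZinf : Z.Infinite)
    (C : X'.IdealSheafData) (hCreg : Scheme.IsRegular C.subscheme) (hCfl : Flat (C.subschemeι ≫ σ' ≫ q))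
    (hCj : C.comap j = vanishingIdeal (⟨Z, hZ⟩ : Closeds F₁))
    (hCoff : ∀ c ∈ (C.support : Set X'), ¬ IsGenericPoint (σ' c) Y)
    (X₁ : Scheme.{0}) (τ₁ : X₁ ⟶ X') (hτ₁ : IsBlowup τ₁ C) (hX₁int : IsIntegral X₁) (hX₁noeth : IsLocallyNoetherian X₁)
    (hX₁reg : Scheme.IsRegular X₁) (hX₁dom : IsDominant ((τ₁ ≫ σ') ≫ q))
    (F₂ : Scheme.{0}) (hF₂ : IsIntegral F₂) (υ : F₂ ⟶ F₁) (hυ : IsBlowup υ (vanishingIdeal (⟨Z, hZ⟩ : Closeds F₁)))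
    (j₂ : F₂ ⟶ X₁) (t₂ : F₂ ⟶ Spec (.of k)) (hsq₂ : IsPullback j₂ t₂ ((τ₁ ≫ σ') ≫ q) (Spec.map (CommRingCat.ofHom θ)))
    (hcomm : j₂ ≫ τ₁ = υ ≫ j) (hirr₂ : IsIrreducible (closure (υ ⁻¹' (T₁ \ Z))))
    (hCh₁ : Ch X₁ (τ₁ ≫ σ') (j₂ '' closure (υ ⁻¹' (T₁ \ Z))))
    -- the two named inputs of N1
    (hcodim : ∀ x ∈ C.support, ringKrullDim (X'.presheaf.stalk x ⧸ stalkIdeal C x) + 2 = ringKrullDim (X'.presheaf.stalk x))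
    (hCrat : RationalCarrier (redSub F₁ Z hZ) →
      ∃ e₁ : C.subscheme ≅ ProjCech.PP O 1, e₁.hom ≫ ProjCech.toSpec O 1 = C.subschemeι ≫ σ' ≫ q) :
    Tower.Inv₂ O k θ P q Y Ch (DirLift.Ruled O k θ P q Y) F₁ Z hZ F₂ υ F₂ (𝟙 F₂) (closure (υ ⁻¹' (T₁ \ Z))) (υ ⁻¹' Z) ∅ ∧
      IsClosed (∅ : Set F₂) ∧ (∅ : Set F₂) ⊆ closure (∅ \ υ ⁻¹' Z) ∧ (∅ : Set F₂) ≠ Set.univ :=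
  Tower.inv₂_noseSeed' O k θ hθ P q Y Ch (DirLift.Ruled O k θ P q Y) X' σ' hX'noeth hX'reg F₁ j t hsq T₁ Z hZ hT₁Z hZinf C hCreg hCj
    hCoff X₁ τ₁ hτ₁ hX₁int hX₁noeth hX₁reg hX₁dom F₂ hF₂ υ hυ j₂ t₂ hsq₂ hcomm hirr₂ hCh₁
    (DirLift.ruled_noseRoot O k θ P q Y X' σ' hX'int hX'noeth hX'reg F₁ j t hsq Z hZ C hCreg hCfl hCj hCoff X₁ τ₁ hτ₁ F₂ υ hυ j₂ t₂
      hsq₂ hcomm hcodim hCrat)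

end Summit.ResolutionOfSingularities.ResolutionOfSingularities.Cruxes.EquisingularLiftNat.Sections

end
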